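import Summits.AtomisticToContinuum.Crystallization.Theorems.CoarseGrains.Negative.PredicateAPI
import Summits.AtomisticToContinuum.Crystallization.Theorems.HcpLiouville.Negative.EquilLoadBearing

/-!
# `FineGrains` / Negative companion: the RELAXED hcp crystal (non-ideal `c/a`) also has fine balls, exactly

Interface check for crux `stmt-AtomisticToContinuum-9330` (`ExcessDecayLiouville.FineGrains`), standing
crux-disprover seat `refuter-cdisprove-stmt-AtomisticToContinuum-9330-0` (2026-08-16); companion of
`HcpModel` (ideal ratio, isotropic cell).  The relaxed Lennard-Jones hcp crystal has `c/a` off the ideal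
`√(8/3)` by `≈ 1.4·10⁻⁴` ((a, h) ≈ (0.971274, 0.792930)); it is the site set of the AXIALLY STRETCHED
cell `A = a·id + δ·P₃` (principal stretches `a, a, a + δ`, `h = (a + δ)√(2/3)`), which is admissible as
soon as `|a − 0.97| + |δ| ≤ 1/40` (`adm_cell`; for the relaxed cell `≈ 0.0014`).  So every
`hcpStacking a h` with `(a, h/√(2/3))` in that window is two-way matched at tolerance `0` on every closed
ball by the datum `t = (0, A(w + √(2/3)e₃))` (`near_relaxedHcpStacking`, via `sites_cell_eq`), and so is
any configuration agreeing with it on the ball (`fineGrains_matrix_of_locally_relaxedHcp`): the crux's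
affine window does absorb the relaxed `c/a`, as the route text asserts.  Nothing here closes an item; no
theorem concludes a Theses decl.
-/

noncomputable section

open Literature.MathematicalPhysics.StatisticalMechanics

namespace Summit.AtomisticToContinuum.Crystallization.Theorems.FineGrains.Negative.HcpModelRelaxed

open Summit.AtomisticToContinuum.Crystallization.Theorems.CoarseGrains.Negative.PredicateAPI

/-- The axial projector `P₃ w = (w 2) e₃`. -/
def P3 : E3 →L[ℝ] E3 :=
  (EuclideanSpace.proj (2 : Fin 3) : E3 →L[ℝ] ℝ).smulRight (EuclideanSpace.single (2 : Fin 3) (1 : ℝ))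

/-- `P₃ w = (w 2)·e₃`. [folklore] -/
theorem P3_apply (w : E3) : P3 w = (w 2) • EuclideanSpace.single (2 : Fin 3) (1 : ℝ) := by
  simp [P3]

/-- Coordinates of `P₃ w`. [folklore] -/
theorem P3_coord (w : E3) (l : Fin 3) : (P3 w) l = if l = 2 then w 2 else 0 := by
  rw [P3_apply]
  fin_cases l <;> simp

/-- `‖P₃ w‖ ≤ ‖w‖`. [folklore] -/
theorem norm_P3_apply_le (w : E3) : ‖P3 w‖ ≤ ‖w‖ := by
  rw [P3_apply, norm_smul, PiLp.norm_single, norm_one, mul_one, Real.norm_eq_abs]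
  exact abs_apply_le_norm w 2

/-- The axially stretched cell `A = a·id + δ·P₃` (principal stretches `a, a, a + δ`). -/
def cell (a δ : ℝ) : E3 →L[ℝ] E3 := a • ContinuousLinearMap.id ℝ E3 + δ • P3

/-- First coordinate of `A w`: `a·w₀`. [folklore] -/
theorem cell_apply0 (a δ : ℝ) (w : E3) : (cell a δ w) 0 = a * w 0 := by
  simp [cell, P3_coord]

/-- Second coordinate of `A w`: `a·w₁`. [folklore] -/
theorem cell_apply1 (a δ : ℝ) (w : E3) : (cell a δ w) 1 = a * w 1 := by
  simp [cell, P3_coord]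

/-- Third coordinate of `A w`: `(a + δ)·w₂`. [folklore] -/
theorem cell_apply2 (a δ : ℝ) (w : E3) : (cell a δ w) 2 = (a + δ) * w 2 := by
  simp [cell, P3_coord]; ring

/-- Axially stretched cells with `|a − 0.97| + |δ| ≤ 1/40` are admissible. [folklore] -/
theorem adm_cell {a δ : ℝ} (h : |a - 97 / 100| + |δ| ≤ 1 / 40) : Adm (cell a δ) := by
  refine ⟨LinearIsometryEquiv.refl ℝ E3, ?_⟩
  have h0 : cell a δ - (97 / 100 : ℝ) •
      ((LinearIsometryEquiv.refl ℝ E3).toContinuousLinearEquiv : E3 →L[ℝ] E3) =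
      (a - 97 / 100) • ContinuousLinearMap.id ℝ E3 + δ • P3 := by
    ext w
    simp [cell, sub_smul]
    abel
  rw [h0]
  refine ContinuousLinearMap.opNorm_le_bound _ (by positivity) fun w => ?_
  calc ‖((a - 97 / 100) • ContinuousLinearMap.id ℝ E3 + δ • P3) w‖
        = ‖(a - 97 / 100) • w + δ • P3 w‖ := by simp
    _ ≤ ‖(a - 97 / 100) • w‖ + ‖δ • P3 w‖ := norm_add_le _ _
    _ = |a - 97 / 100| * ‖w‖ + |δ| * ‖P3 w‖ := by rw [norm_smul, norm_smul, Real.norm_eq_abs, Real.norm_eq_abs]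
    _ ≤ |a - 97 / 100| * ‖w‖ + |δ| * ‖w‖ := by gcongr; exact norm_P3_apply_le w
    _ = (|a - 97 / 100| + |δ|) * ‖w‖ := by ring
    _ ≤ 1 / 40 * ‖w‖ := mul_le_mul_of_nonneg_right h (norm_nonneg w)

/-- The relaxed-hcp datum for the cell `A`: `t = (0, A(w + √(2/3)e₃))`. -/
def relaxedDatum (a δ : ℝ) : Fin 2 → E3 :=
  ![0, cell a δ (barlowOffset 1 + layerNormal (Real.sqrt (2 / 3)))]

/-- **The site set of the axially stretched cell is the relaxed hcp stacking**
`hcpStacking a ((a + δ)√(2/3))` (in-plane spacing `a`, layer spacing `h = (a + δ)√(2/3)`). [folklore] -/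
theorem sites_cell_eq (a δ : ℝ) :
    {p : E3 | ∃ m : Fin 2, ∃ z ∈ Lam, p = relaxedDatum a δ m + cell a δ z}
      = hcpStacking a ((a + δ) * Real.sqrt (2 / 3)) := by
  ext p
  constructor
  · rintro ⟨m, z, ⟨i, j, k, rfl⟩, rfl⟩
    fin_cases m
    · refine ⟨2 * k, i, j, ?_⟩
      have hE : haggLabel alternatingHagg (2 * k) = 0 := by
        rw [haggLabel_alternating, if_pos (even_two_mul k)]
      ext l; fin_cases l
      · simp [relaxedDatum, barlowPos, triangularVec₁, triangularVec₂, barlowOffset, layerNormal, hE, cell_apply0]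
        left; ring
      · simp [relaxedDatum, barlowPos, triangularVec₁, triangularVec₂, barlowOffset, layerNormal, hE, cell_apply1]
        left; ring
      · simp [relaxedDatum, barlowPos, triangularVec₁, triangularVec₂, barlowOffset, layerNormal, hE, cell_apply2]
        ring
    · refine ⟨2 * k + 1, i, j, ?_⟩
      have hO : haggLabel alternatingHagg (2 * k + 1) = 1 := by
        rw [haggLabel_alternating, if_neg (Int.not_even_two_mul_add_one k)]
      ext l; fin_cases l
      · simp [relaxedDatum, barlowPos, triangularVec₁, triangularVec₂, barlowOffset, layerNormal, hO, cell_apply0]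
        ring
      · simp [relaxedDatum, barlowPos, triangularVec₁, triangularVec₂, barlowOffset, layerNormal, hO, cell_apply1]
        ring
      · simp [relaxedDatum, barlowPos, triangularVec₁, triangularVec₂, barlowOffset, layerNormal, hO, cell_apply2]
        ring
  · rintro ⟨K, i, j, rfl⟩
    rcases Int.even_or_odd' K with ⟨k, rfl | rfl⟩
    · refine ⟨0, _, ⟨i, j, k, rfl⟩, ?_⟩
      have hE : haggLabel alternatingHagg (2 * k) = 0 := by
        rw [haggLabel_alternating, if_pos (even_two_mul k)]
      ext l; fin_cases l
      · simp [relaxedDatum, barlowPos, triangularVec₁, triangularVec₂, barlowOffset, layerNormal, hE, cell_apply0]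
        left; ring
      · simp [relaxedDatum, barlowPos, triangularVec₁, triangularVec₂, barlowOffset, layerNormal, hE, cell_apply1]
        left; ring
      · simp [relaxedDatum, barlowPos, triangularVec₁, triangularVec₂, barlowOffset, layerNormal, hE, cell_apply2]
        ring
    · refine ⟨1, _, ⟨i, j, k, rfl⟩, ?_⟩
      have hO : haggLabel alternatingHagg (2 * k + 1) = 1 := by
        rw [haggLabel_alternating, if_neg (Int.not_even_two_mul_add_one k)]
      ext l; fin_cases l
      · simp [relaxedDatum, barlowPos, triangularVec₁, triangularVec₂, barlowOffset, layerNormal, hO, cell_apply0]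
        ring
      · simp [relaxedDatum, barlowPos, triangularVec₁, triangularVec₂, barlowOffset, layerNormal, hO, cell_apply1]
        ring
      · simp [relaxedDatum, barlowPos, triangularVec₁, triangularVec₂, barlowOffset, layerNormal, hO, cell_apply2]
        ring

/-- **A set that agrees with the relaxed hcp stacking `hcpStacking a ((a+δ)√(2/3))` on the closed
ball `B_ρ(c)` is two-way matched there at tolerance `0`** by the relaxed datum with cell `a·id + δ·P₃`.
[folklore] -/
theorem near_of_locally_relaxedHcp (a δ : ℝ) {X : Set E3} {c : E3} {ρ : ℝ}
    (h₁ : ∀ p ∈ X, dist p c ≤ ρ → p ∈ hcpStacking a ((a + δ) * Real.sqrt (2 / 3)))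
    (h₂ : ∀ p ∈ hcpStacking a ((a + δ) * Real.sqrt (2 / 3)), dist p c ≤ ρ → p ∈ X) :
    Near X c ρ (relaxedDatum a δ) (cell a δ) 0 := by
  have hS := sites_cell_eq a δ
  refine ⟨fun p hp hpc => ?_, fun m z hz hzc => ?_⟩
  · have hp' : p ∈ hcpStacking a ((a + δ) * Real.sqrt (2 / 3)) := h₁ p hp hpc
    rw [← hS] at hp'
    obtain ⟨m, z, hz, rfl⟩ := hp'
    exact ⟨m, z, hz, by simp⟩
  · have hsite : relaxedDatum a δ m + cell a δ z ∈ hcpStacking a ((a + δ) * Real.sqrt (2 / 3)) := by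
      rw [← hS]; exact ⟨m, z, hz, rfl⟩
    exact ⟨_, h₂ _ hsite hzc, by simp⟩

/-- **The relaxed hcp crystal is two-way matched at tolerance `0` on every ball** by the relaxed datum.
[folklore] -/
theorem near_relaxedHcpStacking (a δ : ℝ) (c : E3) (ρ : ℝ) :
    Near (hcpStacking a ((a + δ) * Real.sqrt (2 / 3))) c ρ (relaxedDatum a δ) (cell a δ) 0 :=
  near_of_locally_relaxedHcp a δ (fun _ hp _ => hp) (fun _ hp _ => hp)

/-- Hence the matrix of `FineGrains` holds, at every tolerance `ε ≥ 0` and every radius, for any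
configuration that coincides on some closed `ρ`-ball with a relaxed hcp crystal `hcpStacking a h`,
`h = (a + δ)√(2/3)`, `|a − 0.97| + |δ| ≤ 1/40` (this covers the relaxed Lennard-Jones cell). [folklore] -/
theorem fineGrains_matrix_of_locally_relaxedHcp {a δ : ℝ} (hA : |a - 97 / 100| + |δ| ≤ 1 / 40) {N : ℕ}
    {x : Fin N → E3} {c : E3} {ρ ε : ℝ} (hε : 0 ≤ ε)
    (h₁ : ∀ p ∈ Set.range x, dist p c ≤ ρ → p ∈ hcpStacking a ((a + δ) * Real.sqrt (2 / 3)))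
    (h₂ : ∀ p ∈ hcpStacking a ((a + δ) * Real.sqrt (2 / 3)), dist p c ≤ ρ → p ∈ Set.range x) :
    ∃ (c' : E3) (t : Fin 2 → E3) (A : E3 →L[ℝ] E3), Adm A ∧ Near (Set.range x) c' ρ t A ε := by
  refine ⟨c, relaxedDatum a δ, cell a δ, adm_cell hA, ?_⟩
  have h0 := near_of_locally_relaxedHcp a δ h₁ h₂
  exact ⟨fun p hp hpc => by
      obtain ⟨m, z, hz, hd⟩ := h0.1 p hp hpc
      exact ⟨m, z, hz, hd.trans hε⟩,
    fun m z hz hzc => by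
      obtain ⟨p, hp, hd⟩ := h0.2 m z hz hzc
      exact ⟨p, hp, hd.trans hε⟩⟩

end Summit.AtomisticToContinuum.Crystallization.Theorems.FineGrains.Negative.HcpModelRelaxed

end
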